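import Summits.QuantumFields.YangMills.Theorems.BalabanUVNodesN16AtRRec12OfRecord
import Summits.QuantumFields.YangMills.Theorems.BalabanUVNodesRateCarriersOfRecord12On
import Summits.QuantumFields.YangMills.Theorems.BalabanUVNodesRateReadingOfRecord12
import HarnessLib

/-!
# Route «BalabanUVNodes», cluster K4 «SpineRates» — node N16 = NE3 AT THE REGIME-RESTRICTED, TUPLE-KEYED STAGE-12 HOME `RRec₁₂On 𝔯 Rg` (dag-n22-e g2, p468431),
# down to RR-1's NE3 object of record and THE NAMED READING OF RECORD `readingOfRecord₁₂ w1 ℓ₃ ne2 ne1` (dag-n22-e g2, p469629): the knit in guarded θ-form,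
# the transfers between the two Stage-12 homes, N21's face, «THE TWO HOMES AGREE AT A CONSTANT NE3 LAYER», the stub from `LeafSlot` ALONE at tuned letters, and the
# junk tests — i.e. the binder `h16 : S_N16 (RRec₁₂On 𝔯 fun F θ => θ.ZtUnity F 2 ∧ θ.SlotsNondegenerate)` of dag-n27-c's K3′ composer
# `N27SpineGivenEndpointR12.spineGivenEndpointR12_of_homes₁₂On` SUPPLIED BY NAME from N16's side (any rank `N`, any regime `Rg`)

Cell `pub-ymgap`, seat `pub-ymgap-dag-n16-e` (R134 acceleration seat (a), strategy s2 = BY-NAME KNIT at the record; HUMAN RULING D-0062; chair R424 venue),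
generation 3, file 12 (THEOREMS ONLY, 0 `def`, 0 `sorry`).  `bears_on: R4∕N16 · K3′ SpineGivenEndpointR12 (stmt-QuantumFields-19908)`.  Filed `--supports
stmt-QuantumFields-19908 --as helper`.  Imports this seat's file 11 `BalabanUVNodesN16AtRRec12OfRecord` (p470038 + v1.1 p472645: the object-of-record faces and the
tuned-letters proviso `inEndRegime_ofRecord_of_letters`; through it files 5–10 and RR-1's `Node00/RateRecord11NE3Data`), dag-n22-e g2's REGIME-RESTRICTED HOME
`BalabanUVNodesRateCarriersOfRecord12On` (p468431: `RRec₁₂On 𝔯 Rg := fun F D g₀ os R => ∃ θ hP, Rg F θ ∧ θ.Admissible F N ∧ D = datumOfRecord₁₂ F N θ hP ∧ ∃ k, R =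
rateCarriersOfRecord₁₂ 𝔯 F θ hP g₀ os k`, its master face `s_N16_rRec₁₂On_iff`, `rRec₁₂On_self`, `RRec₁₂On.isDatumOfRecord₁₂C`, `k4_rRec₁₂On_anti`,
`k4_rRec₁₂_of_rRec₁₂On_true`, `rRec₁₂On_of_regime_params`) and dag-n22-e g2's READING OF RECORD `BalabanUVNodesRateReadingOfRecord12` (p469629: `readingOfRecord₁₂ w1 ℓ₃ ne2
ne1`, face `readingOfRecord₁₂_ne3 : (… .lit F θ hP g₀ os).ne3 k = ne3ConstLayerOfRecord₁₁ F N (ℓ₃ F)` by `rfl`).  Restates nothing; cites by name.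

WHY (pub-ymgap INBOX l.14060 ∕ STATUS l.7424, 2026-08-26T21:49Z; this seat's g2 HANDOFF trigger t4 «re-key»).  The K3′ consumer of record moved to the regime-restricted
home: dag-n27-c g3's module XXVIII `…N27AtRecord12HomeOn` and XXVI v1.2 §5 `spineGivenEndpointR12_of_homes₁₂On` (`…N27SpineGivenEndpointR12` :231) read
`h16 : S_N16 (RRec₁₂On 𝔯 fun F θ => θ.ZtUnity F 2 ∧ θ.SlotsNondegenerate)` — N16 asked ONLY of the admissible Stage-12 tuples with provisos satisfying the item's rev-15
guard, read AT the tuple, no canonical parameter.  This seat's files 6–11 sit at the canonical home `RRec₁₂ 𝔯`; at `RRec₁₂On` N16 had only dag-n22-e's master face.  THIS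
FILE is N16's side of the regime-restricted home, `Rg`-generic (dag-n27-c instantiates `N = 2`, `Rg = guard`; every smaller or larger regime is served by §2).

CONTENT.
§1 THE KNIT, GUARDED θ-FORM — `s_N16_rRec₁₂On_of_inEndRegime_printSlot` ∕ `_leafSlot` (proviso `InEndRegime` ∧ slot at the reading's NE3 bundle for every admissible θ
   with provisos IN `Rg`, along every `(g₀, os, k)` ⇒ `S_N16 (RRec₁₂On 𝔯 Rg)`), `n16At_of_s_N16_rRec₁₂On` (the converse read-out), and the R422 HONESTY FACE
   `s_N16_rRec₁₂On_of_guard_empty`: if NO family has an admissible Stage-12 tuple with provisos in `Rg`, the stub holds VACUOUSLY — so `S_N16 (RRec₁₂On 𝔯 Rg)` carries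
   content exactly on the guarded admissible tuples (their existence at the guard of record = K0′ ∕ RR-2's CN key, OPEN).
§2 TRANSFERS — `s_N16_rRec₁₂On_anti` (antitone in `Rg`), `s_N16_rRec₁₂On_of_rRec₁₂On_true`, `s_N16_rRec₁₂_of_rRec₁₂On_true`, `s_N16_rRec₁₂_of_rRec₁₂On_of_regime_params`.
§3 N21's FACE AT THE REGIME-RESTRICTED HOME — `covRoot_rRec₁₂On` (under the stub, `NE3EnergyRateWCov 4 (sfClass 4 L o.Nper o.ε) L o.Nper o.b o.g o.C o.Λ₁ o.Λ₂' o.dom`,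
   `L = ne3LOfRecord₁₁ F`, `o = (𝔯.lit F θ hP g₀ os).ne3 k`, at every guarded admissible tuple and run length).
§4 CONSTANT NE3 LAYERS — THE TWO STAGE-12 HOMES AGREE: for a reading whose NE3 component is constantly `o F`, `s_N16_rRec₁₂On_iff_of_constLayer`
   (`S_N16 (RRec₁₂On 𝔯 Rg) ↔ ∀ F, (∃ θ, θ.Provisos₁₂ F N ∧ Rg F θ ∧ θ.Admissible F N) → N16At (ne3OfRecord₁₁ F (o F))`), `n16At_of_s_N16_rRec₁₂On_constLayer`,
   `s_N16_rRec₁₂On_of_constLayer(_leafSlot)`, **`s_N16_rRec₁₂On_of_s_N16_rRec₁₂_constLayer`** (`S_N16 (RRec₁₂ 𝔯) → S_N16 (RRec₁₂On 𝔯 Rg)` for EVERY `Rg`: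
   a guarded admissible tuple realises a Stage-12 datum of record — dag-n22-e's `RRec₁₂On.isDatumOfRecord₁₂C`), `s_N16_rRec₁₂On_true_iff_s_N16_rRec₁₂_constLayer`
   (at the trivial regime the two homes are EQUIVALENT for N16).
§5 AT RR-1's NE3 OBJECT OF RECORD `ne3ConstLayerOfRecord₁₁ F N (ℓ F)` — `s_N16_rRec₁₂On_iff_ofRecord`, `s_N16_rRec₁₂On_ofRecord_of_leafSlot`,
   **`s_N16_rRec₁₂On_ofRecord_of_letters_of_leafSlot`** (letters `⟨r, b F, g F, C F, r, Λ₂' F⟩` tuned inside THE END's tolerance — `0 < g F`, `0 ≤ b F ≤ r∕2`,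
   `Cof (g F) ≤ C F` —: `LeafSlot` at ONE bundle per guarded family ⇒ the stub, proviso discharged by file 11 v1.1's `inEndRegime_ofRecord_of_letters`),
   `s_N16_rRec₁₂On_ofRecord_canonical_of_leafSlot` (`b = r∕2`, `C = Cof`).
§6 AT THE NAMED READING OF RECORD `readingOfRecord₁₂ w1 ℓ₃ ne2 ne1` (`hpin := readingOfRecord₁₂_ne3`, `rfl`) — **`s_N16_rRec₁₂On_readingOfRecord₁₂_iff`**,
   `n16At_of_s_N16_rRec₁₂On_readingOfRecord₁₂`, `covRoot_rRec₁₂On_readingOfRecord₁₂` (N21's face at RR-1's period, letters and data), `s_N16_rRec₁₂On_readingOfRecord₁₂_of_leafSlot`,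
   **`s_N16_rRec₁₂On_readingOfRecord₁₂_of_letters_of_leafSlot`** (= dag-n27-c's `h16` AT THE READING OF RECORD with tuned letters, from `LeafSlot` at one bundle per
   guarded family — NO proviso left), `s_N16_rRec₁₂On_readingOfRecord₁₂_of_s_N16_rRec₁₂` (the canonical home feeds the regime-restricted one at the reading).
§7 THE JUNK TESTS AT THE REGIME-RESTRICTED HOME [decided toys] — `s_N16_rRec₁₂On_of_flatReading`, `exists_reading_s_N16_rRec₁₂On`, `not_s_N16_rRec₁₂On_of_negLipReading`,
   `exists_reading_not_s_N16_rRec₁₂On` (given ONE guarded admissible tuple with provisos, SOME reading refutes the stub): decided by the PIN of `𝔯.lit · ne3`.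

HONEST FRAMING.  Kernel bookkeeping by name; no estimate; `InEndRegime` (THE END's thresholds), `PrintSlot` ([Balaban1985RegularSpaces] Theorem 4 in the all-torus
geometry at the record's pairs — N05's) and `LeafSlot` (N05's typed leaf clauses on the univ sub-family of `zdGF3` + N07's [Balaban1985Variational] Thm 1 (8)+(10)
`LeafH3sup`) remain HYPOTHESES, proved nowhere in the tree; the reading `𝔯` is a PARAMETER except in §6, where it is dag-n22-e's named reading of record (edition 1,
W1's container + RR-1's constant layer, two components residual); no admissible Stage-12 tuple with provisos in any regime is claimed to exist (K0′ `Record12Inhabited`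
stmt-QuantumFields-19902 and RR-2's CN key OPEN) — by §1's honesty face the stub is VACUOUS where none exists; LOCATED (this seat, g2): N16's `sfClass`∕`IsMinimiser`
world averages with [Balaban1985Averaging] (42), the record with [Balaban1987RG1] (0.4) — the transfer sits in N21's displayed `hdict`, not here; **N16 ∕ NE3 is NOT
discharged**; count-neutral; one finite four-torus at fixed ε — NOT ℝ⁴, NOT infinite volume, NOT OS, NOT a mass gap, NOT Clay.
-/

set_option autoImplicit false

open scoped BigOperators Matrix Matrix.Norms.L2Operator
open NormedSpace

namespace Summit.QuantumFields.YangMills.BalabanUVNodes.N16AtRRec12On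

open Literature.MathematicalPhysics.QuantumFieldTheory.Balaban1983to89
open Literature.MathematicalPhysics.QuantumFieldTheory.Balaban1983to89.T4Continuum (T4Family ULoop)
open B7Prop1Explicit B7Prop2Explicit
open T4AveragingDeficitWallBoundary (IsPeriodicCfg)
open Node00 (IsDatumOfRecord₁₂C Stage12Params datumOfRecord₁₂ NE3Objects₁₁ NE3Letters₁₁ NE2Objects₁₁ ne3LOfRecord₁₁ ne3ConstLayerOfRecord₁₁ ne3NperOfRecord₁₁
  ne3DomOfRecord₁₁)
open Summit.QuantumFields.BalabanUV.T4Continuum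
open MinimalActionRate (sfClass)
open MinimalActionRefine (gradConst)
open MinimalActionWitness (flatCfg)
open NE3EnergyShapes (IsUnitarySite)
open NE3EnergyWeightedCovShape (NE3EnergyRateWCov)
open YMDAG.UVSplit (Datum NE3Carriers NE1pCarriers RateCarriers RateRecordPred N16At S_N16 ne3OfRecord₁₁ RateReading₁₂ rateCarriersOfRecord₁₂ RRec₁₂ RRec₁₂On
  rRec₁₂On_self s_N16_rRec₁₂On_iff k4_rRec₁₂On_anti k4_rRec₁₂_of_rRec₁₂On_true rRec₁₂On_of_regime_params readingOfRecord₁₂)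
open Summit.QuantumFields.YangMills.BalabanUVNodes.N16Regime (PrintSlot InEndRegime radiusOfRecord constOfRecord n16At_of_inEndRegime_printSlot)
open Summit.QuantumFields.YangMills.BalabanUVNodes.N16LeafSlot (LeafSlot n16At_of_inEndRegime_leafSlot)
open Summit.QuantumFields.YangMills.BalabanUVNodes.N16AtRateRecord11 (n16At_ne3Objects_flatDom)
open Summit.QuantumFields.YangMills.BalabanUVNodes.N16AtKeyedHome (not_s_N16_of_pins_negLip)
open Summit.QuantumFields.YangMills.BalabanUVNodes.N16AtRRec12 (exists_reading₁₂_ne3_const)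
open Summit.QuantumFields.YangMills.BalabanUVNodes.N16AtRRec12ConstLayer (n16At_of_s_N16_rRec₁₂_constLayer)
open Summit.QuantumFields.YangMills.BalabanUVNodes.N16AtRRec12OfRecord (inEndRegime_ofRecord_canonical inEndRegime_ofRecord_of_letters)

noncomputable section

variable {N : ℕ} [NeZero N] (𝔯 : RateReading₁₂ N) (Rg : (F : T4Family) → Stage12Params F N → Prop)

/-! ## §1 The knit at the regime-restricted home — guarded θ-form; the honesty face -/

/-- **THE KNIT AT THE REGIME-RESTRICTED STAGE-12 HOME, PRINT FORM**: if for every family, every admissible Stage-12 tuple `θ` with provisos `hP` IN THE REGIME `Rg F θ`,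
every `(g₀, os)` and run length `k` the reading's NE3 bundle `ne3OfRecord₁₁ F ((𝔯.lit F θ hP g₀ os).ne3 k)` satisfies the proviso `InEndRegime` and carries `PrintSlot`,
then `S_N16 (RRec₁₂On 𝔯 Rg)` — dag-n22-e's master face `s_N16_rRec₁₂On_iff` closed by file 1's one-application closer.  Neither hypothesis is asserted here. [folklore] -/
theorem s_N16_rRec₁₂On_of_inEndRegime_printSlot
    (h : ∀ (F : T4Family) (θ : Stage12Params F N) (hP : θ.Provisos₁₂ F N), Rg F θ → θ.Admissible F N →
      ∀ (g₀ : ℕ → ℝ) (os : List (ULoop F)) (k : ℕ),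
        InEndRegime (ne3OfRecord₁₁ F ((𝔯.lit F θ hP g₀ os).ne3 k)) ∧ PrintSlot (ne3OfRecord₁₁ F ((𝔯.lit F θ hP g₀ os).ne3 k))) :
    S_N16 (RRec₁₂On 𝔯 Rg) :=
  (s_N16_rRec₁₂On_iff 𝔯 Rg).2 fun F θ hP hRg hθ g₀ os k =>
    n16At_of_inEndRegime_printSlot (h F θ hP hRg hθ g₀ os k).1 (h F θ hP hRg hθ g₀ os k).2

/-- **THE KNIT AT THE REGIME-RESTRICTED STAGE-12 HOME, LEAF FORM** (`LeafSlot`: N05's typed leaf clauses on the univ sub-family of `zdGF3` + N07's `LeafH3sup`, file 7's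
closer). [folklore] -/
theorem s_N16_rRec₁₂On_of_inEndRegime_leafSlot
    (h : ∀ (F : T4Family) (θ : Stage12Params F N) (hP : θ.Provisos₁₂ F N), Rg F θ → θ.Admissible F N →
      ∀ (g₀ : ℕ → ℝ) (os : List (ULoop F)) (k : ℕ),
        InEndRegime (ne3OfRecord₁₁ F ((𝔯.lit F θ hP g₀ os).ne3 k)) ∧ LeafSlot (ne3OfRecord₁₁ F ((𝔯.lit F θ hP g₀ os).ne3 k))) :
    S_N16 (RRec₁₂On 𝔯 Rg) :=
  (s_N16_rRec₁₂On_iff 𝔯 Rg).2 fun F θ hP hRg hθ g₀ os k =>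
    n16At_of_inEndRegime_leafSlot (h F θ hP hRg hθ g₀ os k).1 (h F θ hP hRg hθ g₀ os k).2

/-- **THE READ-OUT**: under `S_N16 (RRec₁₂On 𝔯 Rg)`, `N16At` at the reading's NE3 bundle of every guarded admissible tuple with provisos, `(g₀, os)` and run length
(dag-n22-e's master face, forward). [folklore] -/
theorem n16At_of_s_N16_rRec₁₂On (hS : S_N16 (RRec₁₂On 𝔯 Rg)) (F : T4Family) (θ : Stage12Params F N) (hP : θ.Provisos₁₂ F N) (hRg : Rg F θ)
    (hθ : θ.Admissible F N) (g₀ : ℕ → ℝ) (os : List (ULoop F)) (k : ℕ) : N16At (ne3OfRecord₁₁ F ((𝔯.lit F θ hP g₀ os).ne3 k)) :=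
  (s_N16_rRec₁₂On_iff 𝔯 Rg).1 hS F θ hP hRg hθ g₀ os k

/-- **HONESTY FACE (R422): THE STUB AT THE REGIME-RESTRICTED HOME IS VACUOUS WHEN THE GUARD IS EMPTY** — if no family has an admissible Stage-12 tuple with provisos in
`Rg`, then `S_N16 (RRec₁₂On 𝔯 Rg)` for EVERY reading, content-free.  The existence of a guarded admissible tuple (K0′ ∕ RR-2's CN key) is where the stub starts to bite
(§7's `exists_reading_not_s_N16_rRec₁₂On`). [folklore] -/
theorem s_N16_rRec₁₂On_of_guard_empty (hempty : ∀ (F : T4Family) (θ : Stage12Params F N), θ.Provisos₁₂ F N → Rg F θ → ¬ θ.Admissible F N) :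
    S_N16 (RRec₁₂On 𝔯 Rg) :=
  (s_N16_rRec₁₂On_iff 𝔯 Rg).2 fun F θ hP hRg hθ _ _ _ => absurd hθ (hempty F θ hP hRg)

/-! ## §2 Transfers: antitone in the regime; to and from the canonical home -/

/-- **ANTITONE IN THE REGIME**: the stub over a larger regime gives the stub over every smaller one (dag-n22-e's `k4_rRec₁₂On_anti`, N16 cut). [folklore] -/
theorem s_N16_rRec₁₂On_anti {Rg Rg' : (F : T4Family) → Stage12Params F N → Prop} (h : ∀ F θ, Rg F θ → Rg' F θ) (hS : S_N16 (RRec₁₂On 𝔯 Rg')) :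
    S_N16 (RRec₁₂On 𝔯 Rg) :=
  (k4_rRec₁₂On_anti 𝔯 h).2.2.1 hS

/-- **FROM THE TRIVIAL REGIME TO ANY REGIME.** [folklore] -/
theorem s_N16_rRec₁₂On_of_rRec₁₂On_true (hS : S_N16 (RRec₁₂On 𝔯 fun _ _ => True)) : S_N16 (RRec₁₂On 𝔯 Rg) :=
  s_N16_rRec₁₂On_anti 𝔯 (fun _ _ _ => trivial) hS

/-- **TO THE CANONICAL HOME** `RRec₁₂ 𝔯` (layer B, p466281) from the trivial regime (dag-n22-e's `k4_rRec₁₂_of_rRec₁₂On_true`, N16 cut). [folklore] -/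
theorem s_N16_rRec₁₂_of_rRec₁₂On_true (hS : S_N16 (RRec₁₂On 𝔯 fun _ _ => True)) : S_N16 (RRec₁₂ 𝔯) :=
  (k4_rRec₁₂_of_rRec₁₂On_true 𝔯).2.2.1 hS

/-- **TO THE CANONICAL HOME FROM ANY REGIME CONTAINING THE CANONICAL PARAMETERS OF THE DATA OF RECORD** (dag-n22-e's `rRec₁₂On_of_regime_params`). [folklore] -/
theorem s_N16_rRec₁₂_of_rRec₁₂On_of_regime_params (hreg : ∀ (F : T4Family) (D : Datum F N) (h : IsDatumOfRecord₁₂C F N D), Rg F h.params)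
    (hS : S_N16 (RRec₁₂On 𝔯 Rg)) : S_N16 (RRec₁₂ 𝔯) :=
  fun F D g₀ os R hR => hS F D g₀ os R (rRec₁₂On_of_regime_params 𝔯 Rg hreg hR)

/-! ## §3 N21's face at the regime-restricted home -/

/-- **N21's FACE AT THE REGIME-RESTRICTED STAGE-12 HOME** — under `S_N16 (RRec₁₂On 𝔯 Rg)`, at every guarded admissible tuple with provisos, `(g₀, os)` and run length the
covariant root `NE3EnergyRateWCov 4 (sfClass 4 L o.Nper o.ε) L o.Nper o.b o.g o.C o.Λ₁ o.Λ₂' o.dom` holds, `L = ne3LOfRecord₁₁ F`, `o = (𝔯.lit F θ hP g₀ os).ne3 k` — the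
record decl `N16At` unfolded; what a regime-restricted N21 module reads as `hcov`. [folklore] -/
theorem covRoot_rRec₁₂On (hS : S_N16 (RRec₁₂On 𝔯 Rg)) (F : T4Family) (θ : Stage12Params F N) (hP : θ.Provisos₁₂ F N) (hRg : Rg F θ) (hθ : θ.Admissible F N)
    (g₀ : ℕ → ℝ) (os : List (ULoop F)) (k : ℕ) :
    NE3EnergyRateWCov 4
      (sfClass 4 (ne3LOfRecord₁₁ F) ((𝔯.lit F θ hP g₀ os).ne3 k).Nper ((𝔯.lit F θ hP g₀ os).ne3 k).ε) (ne3LOfRecord₁₁ F) ((𝔯.lit F θ hP g₀ os).ne3 k).Nper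
      ((𝔯.lit F θ hP g₀ os).ne3 k).b ((𝔯.lit F θ hP g₀ os).ne3 k).g ((𝔯.lit F θ hP g₀ os).ne3 k).C ((𝔯.lit F θ hP g₀ os).ne3 k).Λ₁ ((𝔯.lit F θ hP g₀ os).ne3 k).Λ₂'
      ((𝔯.lit F θ hP g₀ os).ne3 k).dom :=
  n16At_of_s_N16_rRec₁₂On 𝔯 Rg hS F θ hP hRg hθ g₀ os k

/-! ## §4 Constant NE3 layers — the two Stage-12 homes agree -/

section ConstLayer

variable (o : T4Family → NE3Objects₁₁ N)

/-- **FOR A CONSTANT-LAYER READING, `S_N16 (RRec₁₂On 𝔯 Rg)` IS ONE `N16At` PER FAMILY CARRYING A GUARDED ADMISSIBLE STAGE-12 TUPLE WITH PROVISOS** — the object `o F`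
does not depend on the tuple, the couplings, the loop string or the run length, so the guarded θ-form collapses to one sentence per family. [folklore] -/
theorem s_N16_rRec₁₂On_iff_of_constLayer
    (hconst : ∀ (F : T4Family) (θ : Stage12Params F N) (hP : θ.Provisos₁₂ F N) (g₀ : ℕ → ℝ) (os : List (ULoop F)) (k : ℕ), (𝔯.lit F θ hP g₀ os).ne3 k = o F) :
    S_N16 (RRec₁₂On 𝔯 Rg) ↔
      ∀ (F : T4Family), (∃ θ : Stage12Params F N, θ.Provisos₁₂ F N ∧ Rg F θ ∧ θ.Admissible F N) → N16At (ne3OfRecord₁₁ F (o F)) := by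
  refine (s_N16_rRec₁₂On_iff 𝔯 Rg).trans ⟨fun h F hF => ?_, fun h F θ hP hRg hθ g₀ os k => ?_⟩
  · obtain ⟨θ, hP, hRg, hθ⟩ := hF
    have h' := h F θ hP hRg hθ (fun _ => 0) [] 0
    rwa [hconst] at h'
  · rw [hconst]
    exact h F ⟨θ, hP, hRg, hθ⟩

/-- **THE `h16` BINDER AT A CONSTANT LAYER, REGIME-RESTRICTED**: under the stub, `N16At (ne3OfRecord₁₁ F (o F))` at every family with a guarded admissible tuple with
provisos. [folklore] -/
theorem n16At_of_s_N16_rRec₁₂On_constLayer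
    (hconst : ∀ (F : T4Family) (θ : Stage12Params F N) (hP : θ.Provisos₁₂ F N) (g₀ : ℕ → ℝ) (os : List (ULoop F)) (k : ℕ), (𝔯.lit F θ hP g₀ os).ne3 k = o F)
    (hS : S_N16 (RRec₁₂On 𝔯 Rg)) (F : T4Family) {θ : Stage12Params F N} (hP : θ.Provisos₁₂ F N) (hRg : Rg F θ) (hθ : θ.Admissible F N) :
    N16At (ne3OfRecord₁₁ F (o F)) :=
  (s_N16_rRec₁₂On_iff_of_constLayer 𝔯 Rg o hconst).1 hS F ⟨θ, hP, hRg, hθ⟩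

/-- **`N16At` ONCE PER GUARDED FAMILY GIVES THE STUB** for a constant-layer reading. [folklore] -/
theorem s_N16_rRec₁₂On_of_constLayer
    (hconst : ∀ (F : T4Family) (θ : Stage12Params F N) (hP : θ.Provisos₁₂ F N) (g₀ : ℕ → ℝ) (os : List (ULoop F)) (k : ℕ), (𝔯.lit F θ hP g₀ os).ne3 k = o F)
    (h16 : ∀ (F : T4Family), (∃ θ : Stage12Params F N, θ.Provisos₁₂ F N ∧ Rg F θ ∧ θ.Admissible F N) → N16At (ne3OfRecord₁₁ F (o F))) :
    S_N16 (RRec₁₂On 𝔯 Rg) :=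
  (s_N16_rRec₁₂On_iff_of_constLayer 𝔯 Rg o hconst).2 h16

/-- **THE KNIT AT A CONSTANT LAYER, REGIME-RESTRICTED, LEAF FORM**. [folklore] -/
theorem s_N16_rRec₁₂On_of_constLayer_leafSlot
    (hconst : ∀ (F : T4Family) (θ : Stage12Params F N) (hP : θ.Provisos₁₂ F N) (g₀ : ℕ → ℝ) (os : List (ULoop F)) (k : ℕ), (𝔯.lit F θ hP g₀ os).ne3 k = o F)
    (h : ∀ (F : T4Family), (∃ θ : Stage12Params F N, θ.Provisos₁₂ F N ∧ Rg F θ ∧ θ.Admissible F N) →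
      InEndRegime (ne3OfRecord₁₁ F (o F)) ∧ LeafSlot (ne3OfRecord₁₁ F (o F))) :
    S_N16 (RRec₁₂On 𝔯 Rg) :=
  s_N16_rRec₁₂On_of_constLayer 𝔯 Rg o hconst fun F hF => n16At_of_inEndRegime_leafSlot (h F hF).1 (h F hF).2

/-- **THE TWO STAGE-12 HOMES AGREE AT A CONSTANT LAYER — CANONICAL ⇒ REGIME-RESTRICTED, EVERY REGIME**: `S_N16 (RRec₁₂ 𝔯) → S_N16 (RRec₁₂On 𝔯 Rg)`.  A guarded admissible
tuple with provisos realises a Stage-12 datum of record (dag-n22-e's `RRec₁₂On.isDatumOfRecord₁₂C` at `rRec₁₂On_self`), at which file 9 reads `N16At (ne3OfRecord₁₁ F (o F))`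
off the canonical home; the object being tuple-free, that is all the regime-restricted home asks.  So this seat's g2 theorems at `RRec₁₂ 𝔯` for RR-1's constant layer
TRANSFER to `RRec₁₂On 𝔯 Rg` by this one application. [folklore] -/
theorem s_N16_rRec₁₂On_of_s_N16_rRec₁₂_constLayer
    (hconst : ∀ (F : T4Family) (θ : Stage12Params F N) (hP : θ.Provisos₁₂ F N) (g₀ : ℕ → ℝ) (os : List (ULoop F)) (k : ℕ), (𝔯.lit F θ hP g₀ os).ne3 k = o F)
    (hS : S_N16 (RRec₁₂ 𝔯)) : S_N16 (RRec₁₂On 𝔯 Rg) :=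
  s_N16_rRec₁₂On_of_constLayer 𝔯 Rg o hconst fun F hF => by
    obtain ⟨θ, hP, hRg, hθ⟩ := hF
    exact n16At_of_s_N16_rRec₁₂_constLayer 𝔯 o hconst hS F (rRec₁₂On_self 𝔯 Rg θ hP hRg hθ (fun _ => 0) [] 0).isDatumOfRecord₁₂C

/-- **… AND AT THE TRIVIAL REGIME THEY ARE EQUIVALENT FOR N16** (`S_N16 (RRec₁₂On 𝔯 fun _ _ => True) ↔ S_N16 (RRec₁₂ 𝔯)` at a constant layer). [folklore] -/
theorem s_N16_rRec₁₂On_true_iff_s_N16_rRec₁₂_constLayer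
    (hconst : ∀ (F : T4Family) (θ : Stage12Params F N) (hP : θ.Provisos₁₂ F N) (g₀ : ℕ → ℝ) (os : List (ULoop F)) (k : ℕ), (𝔯.lit F θ hP g₀ os).ne3 k = o F) :
    S_N16 (RRec₁₂On 𝔯 fun _ _ => True) ↔ S_N16 (RRec₁₂ 𝔯) :=
  ⟨s_N16_rRec₁₂_of_rRec₁₂On_true 𝔯, s_N16_rRec₁₂On_of_s_N16_rRec₁₂_constLayer 𝔯 (fun _ _ => True) o hconst⟩

end ConstLayer

/-! ## §5 At RR-1's NE3 object of record -/

section OfRecord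

variable (ℓ : T4Family → NE3Letters₁₁)

/-- **FOR A READING PINNED AT THE NE3 OBJECT OF RECORD, `S_N16 (RRec₁₂On 𝔯 Rg)` IS ONE `N16At` PER GUARDED FAMILY** — at RR-1's constant layer
`ne3ConstLayerOfRecord₁₁ F N (ℓ F)` (period `2·L^m`, `dom` = all `2·L^m`-periodic `SU(N)` unit-lattice data).  `hpin` is `fun … => rfl` for a reading whose NE3 component is
`Node00.ne3ConstReadingOfRecord₁₁ F N (ℓ F)` (§6). [folklore] -/
theorem s_N16_rRec₁₂On_iff_ofRecord
    (hpin : ∀ (F : T4Family) (θ : Stage12Params F N) (hP : θ.Provisos₁₂ F N) (g₀ : ℕ → ℝ) (os : List (ULoop F)) (k : ℕ),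
      (𝔯.lit F θ hP g₀ os).ne3 k = ne3ConstLayerOfRecord₁₁ F N (ℓ F)) :
    S_N16 (RRec₁₂On 𝔯 Rg) ↔ ∀ (F : T4Family), (∃ θ : Stage12Params F N, θ.Provisos₁₂ F N ∧ Rg F θ ∧ θ.Admissible F N) →
      N16At (ne3OfRecord₁₁ F (ne3ConstLayerOfRecord₁₁ F N (ℓ F))) :=
  s_N16_rRec₁₂On_iff_of_constLayer 𝔯 Rg (fun F => ne3ConstLayerOfRecord₁₁ F N (ℓ F)) hpin

/-- **THE KNIT AT THE OBJECT OF RECORD, REGIME-RESTRICTED, LEAF FORM**: proviso + `LeafSlot` at the one bundle of every guarded family ⇒ the stub. [folklore] -/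
theorem s_N16_rRec₁₂On_ofRecord_of_leafSlot
    (hpin : ∀ (F : T4Family) (θ : Stage12Params F N) (hP : θ.Provisos₁₂ F N) (g₀ : ℕ → ℝ) (os : List (ULoop F)) (k : ℕ),
      (𝔯.lit F θ hP g₀ os).ne3 k = ne3ConstLayerOfRecord₁₁ F N (ℓ F))
    (h : ∀ (F : T4Family), (∃ θ : Stage12Params F N, θ.Provisos₁₂ F N ∧ Rg F θ ∧ θ.Admissible F N) →
      InEndRegime (ne3OfRecord₁₁ F (ne3ConstLayerOfRecord₁₁ F N (ℓ F))) ∧ LeafSlot (ne3OfRecord₁₁ F (ne3ConstLayerOfRecord₁₁ F N (ℓ F)))) :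
    S_N16 (RRec₁₂On 𝔯 Rg) :=
  s_N16_rRec₁₂On_of_constLayer_leafSlot 𝔯 Rg _ hpin h

end OfRecord

/-- **THE KNIT AT THE OBJECT OF RECORD WITH LETTERS TUNED INSIDE THE TOLERANCE, REGIME-RESTRICTED — `LeafSlot` ALONE**: for a reading pinned at RR-1's constant layer with
letters `⟨r, b F, g F, C F, r, Λ₂' F⟩`, `r = radiusOfRecord N F.L (ne3NperOfRecord₁₁ F 0 0)`, inside THE END's tolerance (`0 < g F`, `0 ≤ b F ≤ r∕2`,
`constOfRecord N F.L (ne3NperOfRecord₁₁ F 0 0) (g F) ≤ C F`), `LeafSlot` at the one bundle of every guarded family gives `S_N16 (RRec₁₂On 𝔯 Rg)` — the proviso is file 11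
v1.1's `inEndRegime_ofRecord_of_letters`.  N21's tuned `b⋆ = min (r∕2) (1∕(512·5·8·L²))` is one such choice. [folklore] -/
theorem s_N16_rRec₁₂On_ofRecord_of_letters_of_leafSlot (g b C Λ₂' : T4Family → ℝ) (hg : ∀ F, 0 < g F) (hb₀ : ∀ F, 0 ≤ b F)
    (hb : ∀ F : T4Family, b F ≤ radiusOfRecord N F.L (ne3NperOfRecord₁₁ F 0 0) / 2)
    (hC : ∀ F : T4Family, constOfRecord N F.L (ne3NperOfRecord₁₁ F 0 0) (g F) ≤ C F)
    (hpin : ∀ (F : T4Family) (θ : Stage12Params F N) (hP : θ.Provisos₁₂ F N) (g₀ : ℕ → ℝ) (os : List (ULoop F)) (k : ℕ),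
      (𝔯.lit F θ hP g₀ os).ne3 k = ne3ConstLayerOfRecord₁₁ F N
        ⟨radiusOfRecord N F.L (ne3NperOfRecord₁₁ F 0 0), b F, g F, C F, radiusOfRecord N F.L (ne3NperOfRecord₁₁ F 0 0), Λ₂' F⟩)
    (hslot : ∀ (F : T4Family), (∃ θ : Stage12Params F N, θ.Provisos₁₂ F N ∧ Rg F θ ∧ θ.Admissible F N) →
      LeafSlot (ne3OfRecord₁₁ F (ne3ConstLayerOfRecord₁₁ F N
        ⟨radiusOfRecord N F.L (ne3NperOfRecord₁₁ F 0 0), b F, g F, C F, radiusOfRecord N F.L (ne3NperOfRecord₁₁ F 0 0), Λ₂' F⟩))) :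
    S_N16 (RRec₁₂On 𝔯 Rg) :=
  s_N16_rRec₁₂On_of_constLayer_leafSlot 𝔯 Rg _ hpin fun F hF =>
    ⟨inEndRegime_ofRecord_of_letters F (hg F) (hb₀ F) (hb F) (hC F) (Λ₂' F), hslot F hF⟩

/-- **THE KNIT AT THE OBJECT OF RECORD WITH THE CANONICAL LETTERS, REGIME-RESTRICTED — `LeafSlot` ALONE** (`⟨r, r∕2, g F, Cof (g F), r, Λ₂' F⟩`; file 11's
`inEndRegime_ofRecord_canonical`). [folklore] -/
theorem s_N16_rRec₁₂On_ofRecord_canonical_of_leafSlot (g Λ₂' : T4Family → ℝ) (hg : ∀ F, 0 < g F)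
    (hpin : ∀ (F : T4Family) (θ : Stage12Params F N) (hP : θ.Provisos₁₂ F N) (g₀ : ℕ → ℝ) (os : List (ULoop F)) (k : ℕ),
      (𝔯.lit F θ hP g₀ os).ne3 k = ne3ConstLayerOfRecord₁₁ F N
        ⟨radiusOfRecord N F.L (ne3NperOfRecord₁₁ F 0 0), radiusOfRecord N F.L (ne3NperOfRecord₁₁ F 0 0) / 2, g F,
          constOfRecord N F.L (ne3NperOfRecord₁₁ F 0 0) (g F), radiusOfRecord N F.L (ne3NperOfRecord₁₁ F 0 0), Λ₂' F⟩)
    (hslot : ∀ (F : T4Family), (∃ θ : Stage12Params F N, θ.Provisos₁₂ F N ∧ Rg F θ ∧ θ.Admissible F N) →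
      LeafSlot (ne3OfRecord₁₁ F (ne3ConstLayerOfRecord₁₁ F N
        ⟨radiusOfRecord N F.L (ne3NperOfRecord₁₁ F 0 0), radiusOfRecord N F.L (ne3NperOfRecord₁₁ F 0 0) / 2, g F,
          constOfRecord N F.L (ne3NperOfRecord₁₁ F 0 0) (g F), radiusOfRecord N F.L (ne3NperOfRecord₁₁ F 0 0), Λ₂' F⟩))) :
    S_N16 (RRec₁₂On 𝔯 Rg) :=
  s_N16_rRec₁₂On_of_constLayer_leafSlot 𝔯 Rg _ hpin fun F hF => ⟨inEndRegime_ofRecord_canonical F (hg F) (Λ₂' F), hslot F hF⟩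

/-! ## §6 At the named reading of record `readingOfRecord₁₂ w1 ℓ₃ ne2 ne1` -/

section ReadingOfRecord

variable (w1 : (F : T4Family) → (θ : Stage12Params F N) → Node00.W1.ReadingData F (Node00.MatA N) θ.τ9.M) (ℓ₃ : T4Family → NE3Letters₁₁)
  (ne2 : (F : T4Family) → Stage12Params F N → (ℕ → ℝ) → List (ULoop F) → ℕ → NE2Objects₁₁)
  (ne1 : (F : T4Family) → Stage12Params F N → (ℕ → ℝ) → List (ULoop F) → NE1pCarriers)

/-- **N16 AT THE READING OF RECORD, REGIME-RESTRICTED HOME**: `S_N16 (RRec₁₂On (readingOfRecord₁₂ w1 ℓ₃ ne2 ne1) Rg)` IS «`N16At (ne3OfRecord₁₁ F (ne3ConstLayerOfRecord₁₁ F N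
(ℓ₃ F)))` for every family carrying an admissible Stage-12 tuple with provisos in `Rg`» — ONE sentence per guarded family about RR-1's NAMED unit-lattice data
(`hpin := readingOfRecord₁₂_ne3`, `rfl`).  At `Rg F θ := θ.ZtUnity F 2 ∧ θ.SlotsNondegenerate`, `N = 2`, the left side is dag-n27-c's binder `h16`. [folklore] -/
theorem s_N16_rRec₁₂On_readingOfRecord₁₂_iff :
    S_N16 (RRec₁₂On (readingOfRecord₁₂ w1 ℓ₃ ne2 ne1) Rg) ↔ ∀ (F : T4Family), (∃ θ : Stage12Params F N, θ.Provisos₁₂ F N ∧ Rg F θ ∧ θ.Admissible F N) →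
      N16At (ne3OfRecord₁₁ F (ne3ConstLayerOfRecord₁₁ F N (ℓ₃ F))) :=
  s_N16_rRec₁₂On_iff_ofRecord (readingOfRecord₁₂ w1 ℓ₃ ne2 ne1) Rg ℓ₃ fun _ _ _ _ _ _ => rfl

/-- **THE `h16` READ-OUT AT THE READING OF RECORD**: under the stub, `N16At` at RR-1's layer of every guarded family. [folklore] -/
theorem n16At_of_s_N16_rRec₁₂On_readingOfRecord₁₂ (hS : S_N16 (RRec₁₂On (readingOfRecord₁₂ w1 ℓ₃ ne2 ne1) Rg)) (F : T4Family) {θ : Stage12Params F N}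
    (hP : θ.Provisos₁₂ F N) (hRg : Rg F θ) (hθ : θ.Admissible F N) : N16At (ne3OfRecord₁₁ F (ne3ConstLayerOfRecord₁₁ F N (ℓ₃ F))) :=
  (s_N16_rRec₁₂On_readingOfRecord₁₂_iff Rg w1 ℓ₃ ne2 ne1).1 hS F ⟨θ, hP, hRg, hθ⟩

/-- **N21's FACE AT THE READING OF RECORD, REGIME-RESTRICTED**: under the stub, at every guarded family the covariant root at RR-1's period `ne3NperOfRecord₁₁ F 0 0 = 2·L^m`,
the letters `ℓ₃ F` and the data of record `ne3DomOfRecord₁₁ F N 0 0` (`N16At` unfolded at the object of record). [folklore] -/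
theorem covRoot_rRec₁₂On_readingOfRecord₁₂ (hS : S_N16 (RRec₁₂On (readingOfRecord₁₂ w1 ℓ₃ ne2 ne1) Rg)) (F : T4Family) {θ : Stage12Params F N}
    (hP : θ.Provisos₁₂ F N) (hRg : Rg F θ) (hθ : θ.Admissible F N) :
    NE3EnergyRateWCov 4 (sfClass 4 (ne3LOfRecord₁₁ F) (ne3NperOfRecord₁₁ F 0 0) (ℓ₃ F).ε) (ne3LOfRecord₁₁ F) (ne3NperOfRecord₁₁ F 0 0) (ℓ₃ F).b (ℓ₃ F).g (ℓ₃ F).C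
      (ℓ₃ F).Λ₁ (ℓ₃ F).Λ₂' (ne3DomOfRecord₁₁ F N 0 0) :=
  n16At_of_s_N16_rRec₁₂On_readingOfRecord₁₂ Rg w1 ℓ₃ ne2 ne1 hS F hP hRg hθ

/-- **THE KNIT AT THE READING OF RECORD, REGIME-RESTRICTED, LEAF FORM**: proviso + `LeafSlot` at RR-1's layer of every guarded family ⇒ the stub. [folklore] -/
theorem s_N16_rRec₁₂On_readingOfRecord₁₂_of_leafSlot
    (h : ∀ (F : T4Family), (∃ θ : Stage12Params F N, θ.Provisos₁₂ F N ∧ Rg F θ ∧ θ.Admissible F N) →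
      InEndRegime (ne3OfRecord₁₁ F (ne3ConstLayerOfRecord₁₁ F N (ℓ₃ F))) ∧ LeafSlot (ne3OfRecord₁₁ F (ne3ConstLayerOfRecord₁₁ F N (ℓ₃ F)))) :
    S_N16 (RRec₁₂On (readingOfRecord₁₂ w1 ℓ₃ ne2 ne1) Rg) :=
  s_N16_rRec₁₂On_ofRecord_of_leafSlot (readingOfRecord₁₂ w1 ℓ₃ ne2 ne1) Rg ℓ₃ (fun _ _ _ _ _ _ => rfl) h

/-- **THE KNIT AT THE READING OF RECORD WITH TUNED LETTERS, REGIME-RESTRICTED — `LeafSlot` ALONE**: for the reading of record with NE3 letters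
`ℓ₃ F = ⟨r, b F, g F, C F, r, Λ₂' F⟩` inside THE END's tolerance, `LeafSlot` at RR-1's layer of every guarded family gives
`S_N16 (RRec₁₂On (readingOfRecord₁₂ w1 ℓ₃ ne2 ne1) Rg)` — dag-n27-c's `h16` AT THE NAMED READING from N16's CONTENT alone (N05's leaf ∘ N07's `LeafH3sup`), the proviso
discharged.  What N16 then owes the K3′ composer is exactly `LeafSlot` once per guarded family. [folklore] -/
theorem s_N16_rRec₁₂On_readingOfRecord₁₂_of_letters_of_leafSlot (g b C Λ₂' : T4Family → ℝ) (hg : ∀ F, 0 < g F) (hb₀ : ∀ F, 0 ≤ b F)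
    (hb : ∀ F : T4Family, b F ≤ radiusOfRecord N F.L (ne3NperOfRecord₁₁ F 0 0) / 2)
    (hC : ∀ F : T4Family, constOfRecord N F.L (ne3NperOfRecord₁₁ F 0 0) (g F) ≤ C F)
    (hslot : ∀ (F : T4Family), (∃ θ : Stage12Params F N, θ.Provisos₁₂ F N ∧ Rg F θ ∧ θ.Admissible F N) →
      LeafSlot (ne3OfRecord₁₁ F (ne3ConstLayerOfRecord₁₁ F N
        ⟨radiusOfRecord N F.L (ne3NperOfRecord₁₁ F 0 0), b F, g F, C F, radiusOfRecord N F.L (ne3NperOfRecord₁₁ F 0 0), Λ₂' F⟩))) :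
    S_N16 (RRec₁₂On (readingOfRecord₁₂ w1
      (fun F => ⟨radiusOfRecord N F.L (ne3NperOfRecord₁₁ F 0 0), b F, g F, C F, radiusOfRecord N F.L (ne3NperOfRecord₁₁ F 0 0), Λ₂' F⟩) ne2 ne1) Rg) :=
  s_N16_rRec₁₂On_ofRecord_of_letters_of_leafSlot _ Rg g b C Λ₂' hg hb₀ hb hC (fun _ _ _ _ _ _ => rfl) hslot

/-- **THE TWO HOMES AGREE AT THE READING OF RECORD — CANONICAL ⇒ REGIME-RESTRICTED, EVERY REGIME**: `S_N16 (RRec₁₂ (readingOfRecord₁₂ …)) → S_N16 (RRec₁₂On (readingOfRecord₁₂ …)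
Rg)` (§4 at RR-1's constant layer).  So dag-n22-e's `s_N16_readingOfRecord₁₂_iff` and this seat's g2 object-of-record theorems feed the regime-restricted composer too. [folklore] -/
theorem s_N16_rRec₁₂On_readingOfRecord₁₂_of_s_N16_rRec₁₂ (hS : S_N16 (RRec₁₂ (readingOfRecord₁₂ w1 ℓ₃ ne2 ne1))) :
    S_N16 (RRec₁₂On (readingOfRecord₁₂ w1 ℓ₃ ne2 ne1) Rg) :=
  s_N16_rRec₁₂On_of_s_N16_rRec₁₂_constLayer _ Rg (fun F => ne3ConstLayerOfRecord₁₁ F N (ℓ₃ F)) (fun _ _ _ _ _ _ => rfl) hS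

end ReadingOfRecord

/-! ## §7 The junk tests at the regime-restricted home: the pin of `𝔯.lit · ne3` decides -/

/-- **A READING WITH FLAT NE3 DATA HAS `S_N16 (RRec₁₂On 𝔯 Rg)` FOR EVERY REGIME — CONTENT-FREE** [decided toy]: if every NE3 object of the reading (all families, Stage-12
tuples with provisos, `(g₀, os)`, run lengths) has period `≥ 1`, non-negative `ε, C, Λ₁, Λ₂'` and the flat stratum of its period as data, the stub holds by n16-a's
`n16At_flatStratum` (file 3's `n16At_ne3Objects_flatDom`) — no slot, no estimate, no guard used. [folklore] -/
theorem s_N16_rRec₁₂On_of_flatReading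
    (hflat : ∀ (F : T4Family) (θ : Stage12Params F N) (hP : θ.Provisos₁₂ F N) (g₀ : ℕ → ℝ) (os : List (ULoop F)) (k : ℕ),
      1 ≤ ((𝔯.lit F θ hP g₀ os).ne3 k).Nper ∧ 0 ≤ ((𝔯.lit F θ hP g₀ os).ne3 k).ε ∧ 0 ≤ ((𝔯.lit F θ hP g₀ os).ne3 k).C ∧ 0 ≤ ((𝔯.lit F θ hP g₀ os).ne3 k).Λ₁ ∧
        0 ≤ ((𝔯.lit F θ hP g₀ os).ne3 k).Λ₂' ∧
        ((𝔯.lit F θ hP g₀ os).ne3 k).dom = {v : Site 4 → Fin 4 → (Matrix (Fin N) (Fin N) ℂ)ˣ | IsPeriodicCfg v (((𝔯.lit F θ hP g₀ os).ne3 k).Nper : ℤ) ∧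
          ∃ w : Site 4 → (Matrix (Fin N) (Fin N) ℂ)ˣ, IsUnitarySite w ∧ v = gaugeAct w flatCfg}) :
    S_N16 (RRec₁₂On 𝔯 Rg) :=
  (s_N16_rRec₁₂On_iff 𝔯 Rg).2 fun F θ hP _ _ g₀ os k => by
    obtain ⟨hN, hε, hC, hΛ₁, hΛ₂', hdom⟩ := hflat F θ hP g₀ os k
    exact n16At_ne3Objects_flatDom F _ hN hε hC hΛ₁ hΛ₂' hdom

/-- **ONE READING CLOSES THE STUB AT THE REGIME-RESTRICTED HOME FOR EVERY REGIME** [decided toy]: the constant reading at the flat object of period `1` with zero letters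
(file 6's `exists_reading₁₂_ne3_const`). [folklore] -/
theorem exists_reading_s_N16_rRec₁₂On :
    ∃ 𝔯 : RateReading₁₂ N, ∀ Rg : (F : T4Family) → Stage12Params F N → Prop, S_N16 (RRec₁₂On 𝔯 Rg) := by
  obtain ⟨𝔯, h𝔯⟩ := exists_reading₁₂_ne3_const (N := N)
    ⟨1, 0, 0, 0, 0, 0, 0, {v : Site 4 → Fin 4 → (Matrix (Fin N) (Fin N) ℂ)ˣ | IsPeriodicCfg v ((1 : ℕ) : ℤ) ∧
      ∃ w : Site 4 → (Matrix (Fin N) (Fin N) ℂ)ˣ, IsUnitarySite w ∧ v = gaugeAct w flatCfg}⟩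
  refine ⟨𝔯, fun Rg => s_N16_rRec₁₂On_of_flatReading 𝔯 Rg fun F θ hP g₀ os k => ?_⟩
  rw [h𝔯 F θ hP g₀ os k]
  exact ⟨le_rfl, le_rfl, le_rfl, le_rfl, le_rfl, rfl⟩

/-- **A READING WITH A NEGATIVE-LIPSCHITZ OBJECT AT SOME GUARDED ADMISSIBLE TUPLE HAS NO `S_N16 (RRec₁₂On 𝔯 Rg)`** [decided toy]: if at some admissible Stage-12 tuple with
provisos IN `Rg`, some `(g₀, os, k)`, the reading's NE3 object has `Λ₁ = −1`, `g = gradConst 4 c′`, `ε, b, c′ ≥ 0` and flat data, the stub FAILS (file 5's key-free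
`not_s_N16_of_pins_negLip` at dag-n22-e's `rRec₁₂On_self`). [folklore] -/
theorem not_s_N16_rRec₁₂On_of_negLipReading {F : T4Family} {θ : Stage12Params F N} (hP : θ.Provisos₁₂ F N) (hRg : Rg F θ) (hθ : θ.Admissible F N)
    (g₀ : ℕ → ℝ) (os : List (ULoop F)) (k : ℕ) {c' : ℝ} (hε : 0 ≤ ((𝔯.lit F θ hP g₀ os).ne3 k).ε) (hb : 0 ≤ ((𝔯.lit F θ hP g₀ os).ne3 k).b) (hc' : 0 ≤ c')
    (hg : ((𝔯.lit F θ hP g₀ os).ne3 k).g = gradConst 4 c') (hΛ₁ : ((𝔯.lit F θ hP g₀ os).ne3 k).Λ₁ = -1)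
    (hdom : ((𝔯.lit F θ hP g₀ os).ne3 k).dom = {v : Site 4 → Fin 4 → (Matrix (Fin N) (Fin N) ℂ)ˣ | IsPeriodicCfg v (((𝔯.lit F θ hP g₀ os).ne3 k).Nper : ℤ) ∧
      ∃ w : Site 4 → (Matrix (Fin N) (Fin N) ℂ)ˣ, IsUnitarySite w ∧ v = gaugeAct w flatCfg}) :
    ¬ S_N16 (RRec₁₂On 𝔯 Rg) :=
  not_s_N16_of_pins_negLip (RRec₁₂On 𝔯 Rg) (rRec₁₂On_self 𝔯 Rg θ hP hRg hθ g₀ os k) ((𝔯.lit F θ hP g₀ os).ne3 k) rfl hε hb hc' hg hΛ₁ hdom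

/-- **GIVEN ONE GUARDED ADMISSIBLE TUPLE WITH PROVISOS, SOME READING REFUTES THE STUB AT THE REGIME-RESTRICTED HOME** [decided toy] (the hypothesis is the `Rg`-shadow of
K0′ `Record12Inhabited` — at the guard of record, RR-2's CN key —, OPEN: claimed by no one): the constant reading at the `Λ₁ = −1` flat object.  Together with
`exists_reading_s_N16_rRec₁₂On`: the stub at `RRec₁₂On 𝔯 Rg` is decided by the PIN of the reading's NE3 component, exactly as at `RRec₁₂ 𝔯`. [folklore] -/
theorem exists_reading_not_s_N16_rRec₁₂On (hex : ∃ (F : T4Family) (θ : Stage12Params F N), θ.Provisos₁₂ F N ∧ Rg F θ ∧ θ.Admissible F N) :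
    ∃ 𝔯 : RateReading₁₂ N, ¬ S_N16 (RRec₁₂On 𝔯 Rg) := by
  obtain ⟨F, θ, hP, hRg, hθ⟩ := hex
  obtain ⟨𝔯, h𝔯⟩ := exists_reading₁₂_ne3_const (N := N)
    ⟨1, 0, 0, gradConst 4 0, 0, -1, 0, {v : Site 4 → Fin 4 → (Matrix (Fin N) (Fin N) ℂ)ˣ | IsPeriodicCfg v ((1 : ℕ) : ℤ) ∧
      ∃ w : Site 4 → (Matrix (Fin N) (Fin N) ℂ)ˣ, IsUnitarySite w ∧ v = gaugeAct w flatCfg}⟩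
  have ho := h𝔯 F θ hP (fun _ => 0) [] 0
  refine ⟨𝔯, not_s_N16_rRec₁₂On_of_negLipReading 𝔯 Rg hP hRg hθ (fun _ => 0) [] 0 (c' := 0) ?_ ?_ le_rfl ?_ ?_ ?_⟩
  · rw [ho]
  · rw [ho]
  · rw [ho]
  · rw [ho]
  · rw [ho]

end

end Summit.QuantumFields.YangMills.BalabanUVNodes.N16AtRRec12On
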